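import Literature.MathematicalPhysics.QuantumFieldTheory.StrongCouplingActivities
import Literature.MathematicalPhysics.QuantumLattice.NarrowWellPlaquetteAction
import HarnessLib

/-!
# One-link integrals for `SU(2)`: the gluing rules of the strong-coupling expansion

Group integration over a single link variable is the basic step of every strong-coupling
(character) expansion of lattice gauge theory (Creutz, *Quarks, gluons and lattices*, Ch. 8;
Drouffe–Zuber, Phys. Rep. 102 (1983) §3; Montvay–Münster §3.4). For the defining representation
of `SU(2)` the two rules are

* **merge** `∫ tr(A u) tr(u⁻¹ B) du = tr(A B) / 2`,
* **split** `∫ tr(A u B u⁻¹) du = tr(A) tr(B) / 2`,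

both consequences of the one-link integral `∫ u_{ij} (u⁻¹)_{kl} du = δ_{il} δ_{jk} / 2`, itself
the statement `∫ u X u⁻¹ du = (tr X / 2) · 1` (left invariance of the Haar measure makes the
left-hand side commute with `SU(2)`; a `2 × 2` matrix commuting with `diag(i, -i)` and with the
rotation by `π/2` is scalar; the scalar is read off from the trace). We prove these for the
normalised Haar measure `haarProbability (Matrix.specialUnitaryGroup (Fin 2) ℂ)` of the tree,
together with the `SU(2)` identity `tr u⁻¹ = tr u` (real: `NarrowWell.trace_im_eq_zero`; so that
plaquette orientations are immaterial). The lift to one link of the lattice product measure is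
done in the Summits-side sequel (box integral of the `S28ᵀ` one bit). These are the rules by
which the Haar integral of a product of plaquette traces over a closed surface is evaluated
(`2^{V - E}` for a sphere with `V` vertices and `E` edges in the fundamental representation).

No definitions are introduced. References: M. Creutz, *Quarks, Gluons and Lattices* (CUP), Ch. 8
[Creutz2022]; J.-M. Drouffe, J.-B. Zuber, Phys. Rep. 102 (1983) 1, §3 [Drouffe1983];
T. Bröcker, T. tom Dieck, GTM 98, II (4.5) [BrockerTomDieck1985].
-/

noncomputable section

open MeasureTheory Matrix Complex
open scoped ComplexConjugate

namespace Literature.MathematicalPhysics.QuantumFieldTheory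

namespace SU2Gluing

/-! ### Algebra of `SU(2)` matrices -/

/-- The trace of an `SU(2)` matrix equals its conjugate. [cite: Creutz2022, Ch. 8 (8.26)] -/
theorem conj_trace_coe (u : Matrix.specialUnitaryGroup (Fin 2) ℂ) :
    conj ((u : Matrix (Fin 2) (Fin 2) ℂ).trace) = (u : Matrix (Fin 2) (Fin 2) ℂ).trace :=
  conj_eq_iff_im.2 (Literature.MathematicalPhysics.QuantumLattice.NarrowWell.trace_im_eq_zero u)

/-- `tr u⁻¹ = tr u` on `SU(2)` (orientation reversal does not change a plaquette trace; `u⁻¹ = u† = a₀ - i a·σ`).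
[cite: Creutz2022, Ch. 8 (8.26)] -/
theorem trace_coe_inv (u : Matrix.specialUnitaryGroup (Fin 2) ℂ) :
    ((u⁻¹ : Matrix.specialUnitaryGroup (Fin 2) ℂ) : Matrix (Fin 2) (Fin 2) ℂ).trace =
      (u : Matrix (Fin 2) (Fin 2) ℂ).trace := by
  rw [← star_eq_inv, Matrix.specialUnitaryGroup.coe_star, Matrix.star_eq_conjTranspose,
    Matrix.trace_conjTranspose, Complex.star_def, conj_trace_coe]

/-- `Re tr u = tr u` on `SU(2)` (as a complex number). [cite: Creutz2022, Ch. 8 (8.26)] -/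
theorem ofReal_trace_re (u : Matrix.specialUnitaryGroup (Fin 2) ℂ) :
    (((u : Matrix (Fin 2) (Fin 2) ℂ).trace.re : ℝ) : ℂ) = (u : Matrix (Fin 2) (Fin 2) ℂ).trace := by
  apply Complex.ext <;> simp [Literature.MathematicalPhysics.QuantumLattice.NarrowWell.trace_im_eq_zero]

/-- The diagonal element `diag(i, -i)` of `SU(2)`. [folklore] -/
private theorem diag_mem : !![I, 0; 0, -I] ∈ Matrix.specialUnitaryGroup (Fin 2) ℂ := by
  rw [Matrix.mem_specialUnitaryGroup_iff, Matrix.mem_unitaryGroup_iff]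
  refine ⟨?_, ?_⟩
  · ext i j
    fin_cases i <;> fin_cases j <;>
      simp [Matrix.mul_apply, Fin.sum_univ_two, Matrix.star_apply]
  · simp [Matrix.det_fin_two]

/-- The rotation by `π/2`, an element of `SU(2)`. [folklore] -/
private theorem rot_mem : !![0, 1; -1, 0] ∈ Matrix.specialUnitaryGroup (Fin 2) ℂ := by
  rw [Matrix.mem_specialUnitaryGroup_iff, Matrix.mem_unitaryGroup_iff]
  refine ⟨?_, ?_⟩
  · ext i j
    fin_cases i <;> fin_cases j <;>
      simp [Matrix.mul_apply, Fin.sum_univ_two, Matrix.star_apply]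
  · simp [Matrix.det_fin_two]

/-- A `2 × 2` complex matrix commuting with `diag(i, -i)` and with the rotation by `π/2` is
scalar (irreducibility of the defining representation of `SU(2)`). [folklore] -/
private theorem offDiag_eq_zero_of_commute (N : Matrix (Fin 2) (Fin 2) ℂ)
    (h1 : !![I, 0; 0, -I] * N = N * !![I, 0; 0, -I])
    (h2 : !![(0 : ℂ), 1; -1, 0] * N = N * !![(0 : ℂ), 1; -1, 0]) :
    N 0 1 = 0 ∧ N 1 0 = 0 ∧ N 1 1 = N 0 0 := by
  have e01 := congrFun (congrFun h1 0) 1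
  have e10 := congrFun (congrFun h1 1) 0
  have e00 := congrFun (congrFun h2 0) 1
  simp [Matrix.mul_apply, Fin.sum_univ_two] at e01 e10 e00
  refine ⟨?_, ?_, ?_⟩
  · have : (2 * I) * N 0 1 = 0 := by linear_combination e01
    simpa [I_ne_zero] using this
  · have : (2 * I) * N 1 0 = 0 := by linear_combination -e10
    simpa [I_ne_zero] using this
  · linear_combination e00

/-! ### Haar integrals over `SU(2)` -/

/-- Matrix entries of `u` are continuous on `SU(2)`. [folklore] -/
private theorem continuous_coe_apply (i j : Fin 2) :
    Continuous fun u : Matrix.specialUnitaryGroup (Fin 2) ℂ => (u : Matrix (Fin 2) (Fin 2) ℂ) i j :=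
  continuous_subtype_val.matrix_elem i j

/-- Matrix entries of `u⁻¹` are continuous on `SU(2)`. [folklore] -/
private theorem continuous_coe_inv_apply (i j : Fin 2) :
    Continuous fun u : Matrix.specialUnitaryGroup (Fin 2) ℂ =>
      ((u⁻¹ : Matrix.specialUnitaryGroup (Fin 2) ℂ) : Matrix (Fin 2) (Fin 2) ℂ) i j :=
  (continuous_subtype_val.comp continuous_inv).matrix_elem i j

/-- Continuous functions on the compact group `SU(2)` are integrable for the Haar probability
measure. [folklore] -/
private theorem integrable_of_continuous {f : Matrix.specialUnitaryGroup (Fin 2) ℂ → ℂ} (hf : Continuous f) :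
    Integrable f (haarProbability (Matrix.specialUnitaryGroup (Fin 2) ℂ)) :=
  hf.integrable_of_hasCompactSupport (HasCompactSupport.of_compactSpace _)

/-- The entries of `u X u⁻¹` are continuous in `u ∈ SU(2)`. [folklore] -/
private theorem continuous_conj_apply (X : Matrix (Fin 2) (Fin 2) ℂ) (a b : Fin 2) :
    Continuous fun u : Matrix.specialUnitaryGroup (Fin 2) ℂ =>
      ((u : Matrix (Fin 2) (Fin 2) ℂ) * X *
        ((u⁻¹ : Matrix.specialUnitaryGroup (Fin 2) ℂ) : Matrix (Fin 2) (Fin 2) ℂ)) a b := by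
  simp only [Matrix.mul_apply]
  refine continuous_finsetSum _ fun e _ => ?_
  exact (continuous_finsetSum _ fun c _ => (continuous_coe_apply a c).mul continuous_const).mul
    (continuous_coe_inv_apply e b)

/-- Conjugating the integrand by a group element conjugates the integrand matrix:
`(g u) X (g u)⁻¹ = g (u X u⁻¹) g⁻¹`, entrywise. [folklore] -/
private theorem conj_mul_apply (X : Matrix (Fin 2) (Fin 2) ℂ) (g u : Matrix.specialUnitaryGroup (Fin 2) ℂ)
    (a b : Fin 2) :
    (((g * u : Matrix.specialUnitaryGroup (Fin 2) ℂ) : Matrix (Fin 2) (Fin 2) ℂ) * X *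
        (((g * u)⁻¹ : Matrix.specialUnitaryGroup (Fin 2) ℂ) : Matrix (Fin 2) (Fin 2) ℂ)) a b =
      ∑ c, ∑ e, (g : Matrix (Fin 2) (Fin 2) ℂ) a c *
        ((g⁻¹ : Matrix.specialUnitaryGroup (Fin 2) ℂ) : Matrix (Fin 2) (Fin 2) ℂ) e b *
          ((u : Matrix (Fin 2) (Fin 2) ℂ) * X *
            ((u⁻¹ : Matrix.specialUnitaryGroup (Fin 2) ℂ) : Matrix (Fin 2) (Fin 2) ℂ)) c e := by
  have : ((g * u : Matrix.specialUnitaryGroup (Fin 2) ℂ) : Matrix (Fin 2) (Fin 2) ℂ) * X *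
      (((g * u)⁻¹ : Matrix.specialUnitaryGroup (Fin 2) ℂ) : Matrix (Fin 2) (Fin 2) ℂ) =
      (g : Matrix (Fin 2) (Fin 2) ℂ) * ((u : Matrix (Fin 2) (Fin 2) ℂ) * X *
        ((u⁻¹ : Matrix.specialUnitaryGroup (Fin 2) ℂ) : Matrix (Fin 2) (Fin 2) ℂ)) *
        ((g⁻¹ : Matrix.specialUnitaryGroup (Fin 2) ℂ) : Matrix (Fin 2) (Fin 2) ℂ) := by
    rw [_root_.mul_inv_rev, Submonoid.coe_mul, Submonoid.coe_mul]
    simp only [Matrix.mul_assoc]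
  rw [this, Matrix.mul_apply]
  simp only [Matrix.mul_apply, Finset.sum_mul]
  rw [Finset.sum_comm]
  refine Finset.sum_congr rfl fun c _ => Finset.sum_congr rfl fun e _ => by ring

/-- **The one-link conjugation integral**: `∫ (u X u⁻¹)_{il} du = δ_{il} tr X / 2` on `SU(2)`
(`∫ u X u⁻¹ du` commutes with `SU(2)` by left invariance, hence is scalar; its trace is `tr X`).
[cite: Creutz2022, Ch. 8 (8.29)–(8.33)] -/
theorem integral_conj_apply (X : Matrix (Fin 2) (Fin 2) ℂ) (i l : Fin 2) :
    ∫ u, ((u : Matrix (Fin 2) (Fin 2) ℂ) * X * ((u⁻¹ : Matrix.specialUnitaryGroup (Fin 2) ℂ) :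
      Matrix (Fin 2) (Fin 2) ℂ)) i l ∂haarProbability (Matrix.specialUnitaryGroup (Fin 2) ℂ) =
      if i = l then X.trace / 2 else 0 := by
  obtain ⟨N, hN⟩ : ∃ N : Matrix (Fin 2) (Fin 2) ℂ, ∀ a b, N a b =
      ∫ u, ((u : Matrix (Fin 2) (Fin 2) ℂ) * X * ((u⁻¹ : Matrix.specialUnitaryGroup (Fin 2) ℂ) :
        Matrix (Fin 2) (Fin 2) ℂ)) a b ∂haarProbability (Matrix.specialUnitaryGroup (Fin 2) ℂ) :=
    ⟨Matrix.of fun a b => ∫ u, ((u : Matrix (Fin 2) (Fin 2) ℂ) * X *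
      ((u⁻¹ : Matrix.specialUnitaryGroup (Fin 2) ℂ) : Matrix (Fin 2) (Fin 2) ℂ)) a b
        ∂haarProbability (Matrix.specialUnitaryGroup (Fin 2) ℂ), fun a b => rfl⟩
  have hFint : ∀ a b, Integrable (fun u : Matrix.specialUnitaryGroup (Fin 2) ℂ =>
      ((u : Matrix (Fin 2) (Fin 2) ℂ) * X * ((u⁻¹ : Matrix.specialUnitaryGroup (Fin 2) ℂ) :
        Matrix (Fin 2) (Fin 2) ℂ)) a b) (haarProbability (Matrix.specialUnitaryGroup (Fin 2) ℂ)) :=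
    fun a b => integrable_of_continuous (continuous_conj_apply X a b)
  -- conjugation invariance: `g N g⁻¹ = N`
  have hkey : ∀ g : Matrix.specialUnitaryGroup (Fin 2) ℂ,
      (g : Matrix (Fin 2) (Fin 2) ℂ) * N *
        ((g⁻¹ : Matrix.specialUnitaryGroup (Fin 2) ℂ) : Matrix (Fin 2) (Fin 2) ℂ) = N := by
    intro g
    ext a b
    have hexp : ((g : Matrix (Fin 2) (Fin 2) ℂ) * N *
        ((g⁻¹ : Matrix.specialUnitaryGroup (Fin 2) ℂ) : Matrix (Fin 2) (Fin 2) ℂ)) a b =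
        ∑ c, ∑ e, (g : Matrix (Fin 2) (Fin 2) ℂ) a c *
          ((g⁻¹ : Matrix.specialUnitaryGroup (Fin 2) ℂ) : Matrix (Fin 2) (Fin 2) ℂ) e b * N c e := by
      simp only [Matrix.mul_apply, Finset.sum_mul]
      rw [Finset.sum_comm]
      refine Finset.sum_congr rfl fun c _ => Finset.sum_congr rfl fun e _ => by ring
    rw [hexp, hN a b, ← integral_mul_left_eq_self _ g]
    simp_rw [conj_mul_apply X g]
    rw [integral_finsetSum _ fun c _ => integrable_finsetSum _ fun e _ => (hFint c e).const_mul _]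
    refine Finset.sum_congr rfl fun c _ => ?_
    rw [integral_finsetSum _ fun e _ => (hFint c e).const_mul _]
    refine Finset.sum_congr rfl fun e _ => ?_
    rw [integral_const_mul, hN c e]
  have hcomm : ∀ g : Matrix.specialUnitaryGroup (Fin 2) ℂ,
      (g : Matrix (Fin 2) (Fin 2) ℂ) * N = N * (g : Matrix (Fin 2) (Fin 2) ℂ) := fun g =>
    calc (g : Matrix (Fin 2) (Fin 2) ℂ) * N
        = (g : Matrix (Fin 2) (Fin 2) ℂ) * N *
            (((g⁻¹ : Matrix.specialUnitaryGroup (Fin 2) ℂ) : Matrix (Fin 2) (Fin 2) ℂ) *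
              (g : Matrix (Fin 2) (Fin 2) ℂ)) := by
          rw [← Submonoid.coe_mul, inv_mul_cancel, Submonoid.coe_one, Matrix.mul_one]
      _ = N * (g : Matrix (Fin 2) (Fin 2) ℂ) := by rw [← Matrix.mul_assoc, hkey]
  -- hence `N` is scalar
  obtain ⟨h01, h10, h11⟩ := offDiag_eq_zero_of_commute N (hcomm ⟨_, diag_mem⟩) (hcomm ⟨_, rot_mem⟩)
  -- the trace of `N` is `tr X`
  have htr : N 0 0 + N 1 1 = X.trace := by
    have h1 : ∀ u : Matrix.specialUnitaryGroup (Fin 2) ℂ,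
        ((u : Matrix (Fin 2) (Fin 2) ℂ) * X * ((u⁻¹ : Matrix.specialUnitaryGroup (Fin 2) ℂ) :
          Matrix (Fin 2) (Fin 2) ℂ)) 0 0 +
        ((u : Matrix (Fin 2) (Fin 2) ℂ) * X * ((u⁻¹ : Matrix.specialUnitaryGroup (Fin 2) ℂ) :
          Matrix (Fin 2) (Fin 2) ℂ)) 1 1 = X.trace := by
      intro u
      rw [← Matrix.trace_fin_two, Matrix.trace_mul_cycle, ← Submonoid.coe_mul, inv_mul_cancel,
        Submonoid.coe_one, Matrix.one_mul]
    rw [hN 0 0, hN 1 1, ← integral_add (hFint 0 0) (hFint 1 1)]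
    simp_rw [h1]
    rw [integral_const, probReal_univ, one_smul]
  have h00 : N 0 0 = X.trace / 2 := by
    rw [← htr, h11]; ring
  rw [← hN i l]
  by_cases h : i = l
  · subst h
    rw [if_pos rfl]
    fin_cases i
    · exact h00
    · exact h11.trans h00
  · rw [if_neg h]
    fin_cases i <;> fin_cases l
    · exact absurd rfl h
    · exact h01
    · exact h10
    · exact absurd rfl h

/-- **The one-link integral** `∫ u_{ai} (u⁻¹)_{kb} du = δ_{ab} δ_{ik} / 2` on `SU(2)`
(Schur orthogonality for the defining representation). [cite: Creutz2022, Ch. 8 (8.33)] -/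
theorem integral_apply_mul_inv_apply (a i k b : Fin 2) :
    ∫ u, (u : Matrix (Fin 2) (Fin 2) ℂ) a i *
        ((u⁻¹ : Matrix.specialUnitaryGroup (Fin 2) ℂ) : Matrix (Fin 2) (Fin 2) ℂ) k b
      ∂haarProbability (Matrix.specialUnitaryGroup (Fin 2) ℂ) =
      if a = b ∧ i = k then 1 / 2 else 0 := by
  have h := integral_conj_apply (Matrix.of fun p q : Fin 2 => if p = i ∧ q = k then (1 : ℂ) else 0) a b
  have hpt : ∀ u : Matrix.specialUnitaryGroup (Fin 2) ℂ,
      ((u : Matrix (Fin 2) (Fin 2) ℂ) * (Matrix.of fun p q : Fin 2 => if p = i ∧ q = k then (1 : ℂ) else 0) *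
        ((u⁻¹ : Matrix.specialUnitaryGroup (Fin 2) ℂ) : Matrix (Fin 2) (Fin 2) ℂ)) a b =
      (u : Matrix (Fin 2) (Fin 2) ℂ) a i *
        ((u⁻¹ : Matrix.specialUnitaryGroup (Fin 2) ℂ) : Matrix (Fin 2) (Fin 2) ℂ) k b := by
    intro u
    fin_cases i <;> fin_cases k <;> simp [Matrix.mul_apply, Fin.sum_univ_two]
  simp_rw [hpt] at h
  rw [h]
  have htr : (Matrix.of fun p q : Fin 2 => if p = i ∧ q = k then (1 : ℂ) else 0).trace =
      if i = k then 1 else 0 := by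
    fin_cases i <;> fin_cases k <;> simp [Matrix.trace_fin_two]
  rw [htr]
  by_cases hab : a = b <;> by_cases hik : i = k <;> simp [hab, hik]

/-- Products of an entry of `u` and an entry of `u⁻¹` are integrable on `SU(2)`. [folklore] -/
private theorem integrable_apply_mul_inv_apply (a i k b : Fin 2) :
    Integrable (fun u : Matrix.specialUnitaryGroup (Fin 2) ℂ => (u : Matrix (Fin 2) (Fin 2) ℂ) a i *
        ((u⁻¹ : Matrix.specialUnitaryGroup (Fin 2) ℂ) : Matrix (Fin 2) (Fin 2) ℂ) k b)
      (haarProbability (Matrix.specialUnitaryGroup (Fin 2) ℂ)) :=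
  integrable_of_continuous ((continuous_coe_apply a i).mul (continuous_coe_inv_apply k b))

/-- **Merge rule** `∫ tr(A u) tr(u⁻¹ B) du = tr(A B) / 2` on `SU(2)` (gluing two plaquettes along
a common link traversed in opposite directions). [cite: Creutz2022, Ch. 8 (8.33)] -/
theorem integral_trace_mul_mul_trace_inv_mul (A B : Matrix (Fin 2) (Fin 2) ℂ) :
    ∫ u, (A * (u : Matrix (Fin 2) (Fin 2) ℂ)).trace *
        (((u⁻¹ : Matrix.specialUnitaryGroup (Fin 2) ℂ) : Matrix (Fin 2) (Fin 2) ℂ) * B).trace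
      ∂haarProbability (Matrix.specialUnitaryGroup (Fin 2) ℂ) = (A * B).trace / 2 := by
  have hpt : ∀ u : Matrix.specialUnitaryGroup (Fin 2) ℂ,
      (A * (u : Matrix (Fin 2) (Fin 2) ℂ)).trace *
        (((u⁻¹ : Matrix.specialUnitaryGroup (Fin 2) ℂ) : Matrix (Fin 2) (Fin 2) ℂ) * B).trace =
      ∑ x : Fin 2 × Fin 2 × Fin 2 × Fin 2, (A x.2.1 x.1 * B x.2.2.2 x.2.2.1) *
        ((u : Matrix (Fin 2) (Fin 2) ℂ) x.1 x.2.1 *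
          ((u⁻¹ : Matrix.specialUnitaryGroup (Fin 2) ℂ) : Matrix (Fin 2) (Fin 2) ℂ) x.2.2.1 x.2.2.2) := by
    intro u
    simp only [Matrix.trace_fin_two, Matrix.mul_apply, Fin.sum_univ_two, Fintype.sum_prod_type]
    ring
  simp_rw [hpt]
  rw [integral_finsetSum _ fun x _ => (integrable_apply_mul_inv_apply _ _ _ _).const_mul _]
  simp_rw [integral_const_mul, integral_apply_mul_inv_apply]
  simp only [Fintype.sum_prod_type, Fin.sum_univ_two, Matrix.trace_fin_two, Matrix.mul_apply]
  simp
  ring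

/-- **Split rule** `∫ tr(A u B u⁻¹) du = tr(A) tr(B) / 2` on `SU(2)` (a link traversed twice, in
opposite directions, by one loop). [cite: Creutz2022, Ch. 8 (8.33)] -/
theorem integral_trace_mul_mul_mul_inv (A B : Matrix (Fin 2) (Fin 2) ℂ) :
    ∫ u, (A * (u : Matrix (Fin 2) (Fin 2) ℂ) * B *
        ((u⁻¹ : Matrix.specialUnitaryGroup (Fin 2) ℂ) : Matrix (Fin 2) (Fin 2) ℂ)).trace
      ∂haarProbability (Matrix.specialUnitaryGroup (Fin 2) ℂ) = A.trace * B.trace / 2 := by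
  have hpt : ∀ u : Matrix.specialUnitaryGroup (Fin 2) ℂ,
      (A * (u : Matrix (Fin 2) (Fin 2) ℂ) * B *
        ((u⁻¹ : Matrix.specialUnitaryGroup (Fin 2) ℂ) : Matrix (Fin 2) (Fin 2) ℂ)).trace =
      ∑ x : Fin 2 × Fin 2 × Fin 2 × Fin 2, (A x.1 x.2.1 * B x.2.2.1 x.2.2.2) *
        ((u : Matrix (Fin 2) (Fin 2) ℂ) x.2.1 x.2.2.1 *
          ((u⁻¹ : Matrix.specialUnitaryGroup (Fin 2) ℂ) : Matrix (Fin 2) (Fin 2) ℂ) x.2.2.2 x.1) := by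
    intro u
    simp only [Matrix.trace_fin_two, Matrix.mul_apply, Fin.sum_univ_two, Fintype.sum_prod_type]
    ring
  simp_rw [hpt]
  rw [integral_finsetSum _ fun x _ => (integrable_apply_mul_inv_apply _ _ _ _).const_mul _]
  simp_rw [integral_const_mul, integral_apply_mul_inv_apply]
  simp only [Fintype.sum_prod_type, Fin.sum_univ_two, Matrix.trace_fin_two]
  simp
  ring

/-- `∫ tr(u) tr(u⁻¹) du = 1` on `SU(2)` (character orthonormality of the defining
representation; also `= ∫ (tr u)² du`). [cite: Creutz2022, Ch. 8 (8.31)] -/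
theorem integral_trace_mul_trace_inv :
    ∫ u, (u : Matrix (Fin 2) (Fin 2) ℂ).trace *
        ((u⁻¹ : Matrix.specialUnitaryGroup (Fin 2) ℂ) : Matrix (Fin 2) (Fin 2) ℂ).trace
      ∂haarProbability (Matrix.specialUnitaryGroup (Fin 2) ℂ) = 1 := by
  have h := integral_trace_mul_mul_trace_inv_mul (1 : Matrix (Fin 2) (Fin 2) ℂ) 1
  simp only [Matrix.one_mul, Matrix.mul_one, Matrix.trace_one, Fintype.card_fin] at h
  rw [h]; norm_num

end SU2Gluing

end Literature.MathematicalPhysics.QuantumFieldTheory
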